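import Literature.NumberTheory.GaloisRepresentations.ContinuousH1SahNoFixedVector
import HarnessLib

/-!
# Sah's lemma relative to a normal subgroup (continuous `H¹`), and the injectivity of restriction

Topic `NumberTheory/GaloisRepresentations`; namespace `Literature.NumberTheory.GaloisRepresentations`.
THEOREMS ONLY (no definition, no named fact), sibling of `ContinuousH1Sah.lean` /
`ContinuousH1SahNoFixedVector.lean`.

**Sah's lemma with a normal subgroup.** Let `G` be a topological group, `X` a topological
`G`-module, `H ⊴ G` a normal subgroup and `z ∈ H` an element commuting with every element of `H`
such that `x ↦ z•x - x` is bijective on `X`. Then `H¹_cont(G, X) = 0`.  (For `H = G` this is the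
tree's `continuousCohomology_one_eq_zero_of_mem_center`, Sah 1968 Prop. 2.7 (b).)  Proof, on
continuous crossed homomorphisms `φ` (`oneCocycleClass_surjective`, `oneCocycleClass_eq_zero_iff`):
Sah's cocycle identity `z•φ(g) - φ(g) = g•φ(z) - φ(z)` holds for every `g` COMMUTING with `z`, so
with `v` the solution of `z•v - v = φ(z)` one gets `φ(g) = g•v - v` on the centraliser of `z`, in
particular on `H`; then for arbitrary `g`, writing `zg = g·(g⁻¹zg)` with `g⁻¹zg ∈ H`, the two
expansions of `φ(zg)` give `z•w = w` for `w = φ(g) - (g•v - v)`, whence `w = 0`.  This is the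
hand-made inflation–restriction step `H¹(G/H, X^H) → H¹(G, X) → H¹(H, X)` with `X^H = 0` and
`H¹(H, X) = 0` (Sah inside `H`), done without leaving `G`.

* `contOneCocycles.rho_sub_apply_of_commute` — Sah's identity for a single commuting pair;
* `contOneCocycles.apply_eq_of_commute` — `φ(g) = g•v - v` on the centraliser of `z`;
* `continuousCohomology_one_eq_zero_of_normal_of_commute`,
  `subsingleton_continuousCohomology_one_of_normal_of_commute` — the vanishing;
* `galoisCohomology.res_one_injective_of_normal_of_commute` — with inflation–restriction
  (`exact_inf_res_holds`, NSW (1.6.7)): for a discrete `Γ_K`-module `M`, a normal subextension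
  `E/K` with `S = Gal(K̄/E)`, a normal subgroup `Γ' ⊴ Γ_K` and `z ∈ Γ'` commuting with `Γ'`
  MODULO `S` and with `z - 1` bijective on `M^S`, the restriction `H¹(K, M) → H¹(E, M)` is
  injective; `galoisCohomology.res_one_injective_of_normal_of_forall_fixed_eq_zero` — the same
  with the bijectivity replaced by "`M` finite and `z` has no non-zero fixed vector on `M`"
  (`bijective_quotientInvariants_sub_self`).

Use (cell bsd-cm, K7t crux `UpperOffV0HSY`, first lemma): `M = E[2^M]` for a CM curve
`y² = x³ + D`, `Γ' = Γ_{K(ω)}` (the elements commuting with `[ω]`), `z` any element of `Γ'` moving a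
`2`-torsion point — there `Gal(K(E[2^M])/K)` has NO central element without fixed vector when
`ω ∉ K`, so the one-step form of Sah's lemma does not apply, but the relative form does.

BSD / the summits are not advanced by this file: it is group-cohomology bookkeeping.

## References

* [Sah1968] C.-H. Sah, *Automorphisms of finite groups*, J. Algebra 10 (1968), 47–68 — Prop. 2.7 (b)
  and its proof, p. 60.
* [NeukirchSchmidtWingberg2008] J. Neukirch, A. Schmidt, K. Wingberg, *Cohomology of Number Fields*,
  2nd ed. (2008), (1.6.7) (inflation–restriction).
-/

noncomputable section

open CategoryTheory Function

universe u v

namespace Literature.NumberTheory.GaloisRepresentations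

open _root_.TopRep _root_.ContinuousCohomology _root_.Topology

/-! ## Sah's lemma relative to a normal subgroup, for a topological representation -/

section Sah

variable {R : Type u} [Ring R] [TopologicalSpace R]
variable {G : Type v} [Group G] [TopologicalSpace G] [IsTopologicalGroup G]
variable (X : TopRep.{v} R G)

omit [IsTopologicalGroup G] in
variable {X} in
/-- **Sah's cocycle identity for one commuting pair.** For a continuous crossed homomorphism
`φ : G → X` and `g` commuting with `z`: `z•φ(g) - φ(g) = g•φ(z) - φ(z)` (expand `φ(zg) = φ(gz)`).
[cite: Sah1968, Prop. 2.7 (b) and its proof, p. 60] -/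
theorem contOneCocycles.rho_sub_apply_of_commute (φ : contOneCocycles X) {z g : G}
    (hc : g * z = z * g) :
    X.ρ z (φ.1 g) - φ.1 g = X.ρ g (φ.1 z) - φ.1 z := by
  have h1 := φ.2 z g
  have h2 := φ.2 g z
  rw [hc, h1] at h2
  -- h2 : φ z + ρ z (φ g) = φ g + ρ g (φ z)
  rw [sub_eq_sub_iff_add_eq_add, add_comm (X.ρ z (φ.1 g)), h2, add_comm]

omit [IsTopologicalGroup G] in
variable {X} in
/-- **`φ(g) = g•v - v` on the centraliser of `z`**: if `x ↦ z•x - x` is bijective on `X` and `v`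
is the solution of `z•v - v = φ(z)`, then every `g` commuting with `z` has `φ(g) = g•v - v`
(Sah's identity and the injectivity of `z - 1`). [cite: Sah1968, Prop. 2.7 (b) and its proof, p. 60] -/
theorem contOneCocycles.apply_eq_of_commute (φ : contOneCocycles X) {z : G}
    (hbij : Bijective fun x : X => X.ρ z x - x) {v : X} (hv : X.ρ z v - v = φ.1 z) {g : G}
    (hc : g * z = z * g) : φ.1 g = X.ρ g v - v := by
  apply hbij.1
  have hcomm : X.ρ z (X.ρ g v) = X.ρ g (X.ρ z v) :=
    calc X.ρ z (X.ρ g v) = (X.ρ z * X.ρ g) v := rfl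
      _ = X.ρ (g * z) v := by rw [← map_mul, hc]
      _ = (X.ρ g * X.ρ z) v := by rw [map_mul]
      _ = X.ρ g (X.ρ z v) := rfl
  change X.ρ z (φ.1 g) - φ.1 g = X.ρ z (X.ρ g v - v) - (X.ρ g v - v)
  rw [contOneCocycles.rho_sub_apply_of_commute φ hc, ← hv]
  simp only [map_sub]
  rw [hcomm]
  abel

variable {X} in
/-- **Sah's lemma relative to a normal subgroup (vanishing form), continuous cohomology.** Let `X`
be a topological `R[G]`-module, `H ⊴ G` normal, `z ∈ H` commuting with every element of `H`, and
suppose `x ↦ z•x - x` is BIJECTIVE on `X`. Then `H¹_cont(G, X) = 0`.  Proof: a class is `[φ]`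
(`oneCocycleClass_surjective`); with `z•v - v = φ(z)`, `φ = ∂v` on `H` (`apply_eq_of_commute`);
for any `g`, comparing `φ(z·g)` with `φ(g·(g⁻¹zg))` (`g⁻¹zg ∈ H`) gives `z•w = w` for
`w = φ(g) - (g•v - v)`, so `w = 0` (`eq_zero_of_rho_eq_of_injective`), i.e. `[φ] = 0`
(`oneCocycleClass_eq_zero_iff`). [cite: Sah1968, Prop. 2.7 (b) and its proof, p. 60] -/
theorem continuousCohomology_one_eq_zero_of_normal_of_commute {H : Subgroup G} [hH : H.Normal]
    {z : G} (hzH : z ∈ H) (hzc : ∀ h ∈ H, h * z = z * h)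
    (hbij : Bijective fun x : X => X.ρ z x - x) (c : continuousCohomology 1 X) : c = 0 := by
  obtain ⟨φ, rfl⟩ := oneCocycleClass_surjective X c
  rw [oneCocycleClass_eq_zero_iff]
  obtain ⟨v, hv⟩ := hbij.2 (φ.1 z)
  have hv' : X.ρ z v - v = φ.1 z := hv
  refine ⟨v, fun g => ?_⟩
  -- `h' = g⁻¹ z g ∈ H`, `z g = g h'`
  set h' : G := g⁻¹ * z * g with hh'
  have hh'H : h' ∈ H := by
    have := hH.conj_mem z hzH g⁻¹
    rwa [inv_inv] at this
  have hzg : z * g = g * h' := by rw [hh']; group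
  have s1 : φ.1 z = X.ρ z v - v := contOneCocycles.apply_eq_of_commute φ hbij hv' rfl
  have s2 : φ.1 h' = X.ρ h' v - v :=
    contOneCocycles.apply_eq_of_commute φ hbij hv' (hzc h' hh'H)
  have hρ : X.ρ g (X.ρ h' v) = X.ρ z (X.ρ g v) :=
    calc X.ρ g (X.ρ h' v) = (X.ρ g * X.ρ h') v := rfl
      _ = X.ρ (z * g) v := by rw [← map_mul, hzg]
      _ = (X.ρ z * X.ρ g) v := by rw [map_mul]
      _ = X.ρ z (X.ρ g v) := rfl
  have e1 := φ.2 z g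
  have e2 := φ.2 g h'
  rw [← hzg, e1, s1, s2, map_sub, hρ] at e2
  -- e2 : ρ z v - v + ρ z (φ g) = φ g + (ρ z (ρ g v) - ρ g v)
  have key : X.ρ z (φ.1 g) = φ.1 g + (X.ρ z (X.ρ g v) - X.ρ g v) - (X.ρ z v - v) :=
    calc X.ρ z (φ.1 g) = (X.ρ z v - v + X.ρ z (φ.1 g)) - (X.ρ z v - v) := by abel
      _ = φ.1 g + (X.ρ z (X.ρ g v) - X.ρ g v) - (X.ρ z v - v) := by rw [e2]
  have hfix : X.ρ z (φ.1 g - (X.ρ g v - v)) = φ.1 g - (X.ρ g v - v) := by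
    simp only [map_sub, key]
    abel
  have hw := eq_zero_of_rho_eq_of_injective (X := X) hbij.1 _ hfix
  rwa [sub_eq_zero] at hw

variable {X} in
/-- Corollary: under the hypotheses of the relative Sah lemma `H¹_cont(G, X)` is a subsingleton.
[cite: Sah1968, Prop. 2.7 (b) and its proof, p. 60] -/
theorem subsingleton_continuousCohomology_one_of_normal_of_commute {H : Subgroup G} [H.Normal]
    {z : G} (hzH : z ∈ H) (hzc : ∀ h ∈ H, h * z = z * h)
    (hbij : Bijective fun x : X => X.ρ z x - x) : Subsingleton (continuousCohomology 1 X) :=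
  ⟨fun a b => by
    rw [continuousCohomology_one_eq_zero_of_normal_of_commute hzH hzc hbij a,
      continuousCohomology_one_eq_zero_of_normal_of_commute hzH hzc hbij b]⟩

end Sah

/-! ## The Galois-cohomology consequence: restriction is injective in degree one -/

section Galois

variable {K : Type u} [Field K] {M : Type u} [AddCommGroup M] [TopologicalSpace M]
  [DiscreteTopology M]

/-- **Restriction `H¹(K, M) → H¹(E, M)` is injective when some `z ∈ Γ' ⊴ Γ_K` commutes with
`Γ'` modulo `Gal(K̄/E)` and `z - 1` is bijective on `M^{Gal(K̄/E)}`** (relative Sah lemma +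
inflation–restriction).  Here `E/K` is a normal subextension of `K̄/K`,
`S = absGaloisFixingSubgroup E = Gal(K̄/E)`, `Γ'` is a normal subgroup of `Γ_K` containing `z`, the
classes of `g z` and `z g` in `Γ_K ⧸ S = Gal(E/K)` agree for every `g ∈ Γ'`, and `x ↦ z•x - x` is
bijective on the invariants `M^S`; the kernel of `res` is the image of inflation from
`H¹(Γ_K ⧸ S, M^S)` (`exact_inf_res_holds`), which vanishes by
`continuousCohomology_one_eq_zero_of_normal_of_commute` applied to the image of `Γ'` in `Γ_K ⧸ S`.
[cite: Sah1968, Prop. 2.7 (b) and its proof, p. 60; NeukirchSchmidtWingberg2008, (1.6.7)] -/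
theorem galoisCohomology.res_one_injective_of_normal_of_commute (ρ : DiscreteGaloisModule K M)
    (E : IntermediateField K (AlgebraicClosure K)) [Normal K E]
    (Γ' : Subgroup (Field.absoluteGaloisGroup K)) [hΓ' : Γ'.Normal] {z : Field.absoluteGaloisGroup K}
    (hz : z ∈ Γ')
    (hzc : ∀ g ∈ Γ', ((g * z : Field.absoluteGaloisGroup K) :
        Field.absoluteGaloisGroup K ⧸ absGaloisFixingSubgroup E) =
      ((z * g : Field.absoluteGaloisGroup K) : Field.absoluteGaloisGroup K ⧸ absGaloisFixingSubgroup E))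
    (hbij : Bijective fun x : Representation.invariants
        (ρ.toRepresentation.comp (absGaloisFixingSubgroup E).subtype) =>
      ρ.quotientInvariants (absGaloisFixingSubgroup E) (z : _ ⧸ absGaloisFixingSubgroup E) x - x) :
    Injective (galoisCohomology.res ρ E 1) := by
  have hex := exact_inf_res_holds K M ρ E
  set S := absGaloisFixingSubgroup E with hS
  haveI : (Γ'.map (QuotientGroup.mk' S)).Normal :=
    Subgroup.Normal.map hΓ' _ (QuotientGroup.mk'_surjective S)
  have hzH : (z : Field.absoluteGaloisGroup K ⧸ S) ∈ Γ'.map (QuotientGroup.mk' S) :=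
    Subgroup.mem_map_of_mem _ hz
  have hzc' : ∀ h ∈ Γ'.map (QuotientGroup.mk' S),
      h * (z : Field.absoluteGaloisGroup K ⧸ S) = (z : Field.absoluteGaloisGroup K ⧸ S) * h := by
    rintro _ ⟨g, hg, rfl⟩
    rw [QuotientGroup.mk'_apply, ← QuotientGroup.mk_mul, ← QuotientGroup.mk_mul]
    exact hzc g hg
  refine (injective_iff_map_eq_zero _).mpr fun x hx => ?_
  obtain ⟨y, rfl⟩ := (hex x).mp hx
  rw [continuousCohomology_one_eq_zero_of_normal_of_commute
    (X := (ρ.quotientInvariants S).toTopRep) hzH hzc' hbij y, map_zero]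

/-- **Restriction `H¹(K, M) → H¹(E, M)` is injective when some `z ∈ Γ' ⊴ Γ_K`, commuting with
`Γ'` modulo `Gal(K̄/E)`, has no non-zero fixed vector on the finite module `M`** (the previous
theorem with `bijective_quotientInvariants_sub_self`).
[cite: Sah1968, Prop. 2.7 (b) and its proof, p. 60; NeukirchSchmidtWingberg2008, (1.6.7)] -/
theorem galoisCohomology.res_one_injective_of_normal_of_forall_fixed_eq_zero [Finite M]
    (ρ : DiscreteGaloisModule K M) (E : IntermediateField K (AlgebraicClosure K)) [Normal K E]
    (Γ' : Subgroup (Field.absoluteGaloisGroup K)) [Γ'.Normal] {z : Field.absoluteGaloisGroup K}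
    (hz : z ∈ Γ')
    (hzc : ∀ g ∈ Γ', ((g * z : Field.absoluteGaloisGroup K) :
        Field.absoluteGaloisGroup K ⧸ absGaloisFixingSubgroup E) =
      ((z * g : Field.absoluteGaloisGroup K) : Field.absoluteGaloisGroup K ⧸ absGaloisFixingSubgroup E))
    (hfix : ∀ m : M, ρ z m = m → m = 0) :
    Injective (galoisCohomology.res ρ E 1) :=
  galoisCohomology.res_one_injective_of_normal_of_commute ρ E Γ' hz hzc
    (bijective_quotientInvariants_sub_self ρ (absGaloisFixingSubgroup E) hfix)

end Galois

end Literature.NumberTheory.GaloisRepresentations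

end
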